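import Literature.Analysis.FunctionSpaces.TorusLipschitzFourierH1
import HarnessLib

/-!
# Multiplication by a function that is bounded and Lipschitz along one coordinate acts on the
# spectral `H¹` of the flat torus (Leibniz rule, difference-quotient form)

Analysis/FunctionSpaces support file (everything proved; no definitions, no named facts; global
`volume` convention of `FlatTorus`, statements through `UnitAddTorus.mFourierCoeff`). For
`g ∈ L²(T^d; ℂ)`, a coordinate `p`, and a measurable multiplier `χ : T^d → ℂ` with `‖χ‖ ≤ B` and the
one-sided directional Lipschitz bound `‖χ(x + s𝐞ₚ) - χ(x)‖ ≤ |s| Λ(x)` for `|s| ≤ s₀`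
(`𝐞ₚ s = Pi.single p (s : ℝ/ℤ)`, `Λ : T^d → [0, ∞]` arbitrary, e.g. `Lip(χ) 𝟙_{collar}` for a cut-off
that is locally constant off a collar), and every `ε > 0`:

  `∑ₙ nₚ² ‖𝓕(χg)(n)‖² ≤ (1 + ε) B² ∑ₙ nₚ² ‖ĝ(n)‖² + (1 + ε⁻¹) (4π²)⁻¹ ∫⁻ Λ² ‖g‖²`

(`Torus.tsum_sq_mul_enorm_mFourierCoeff_mul_le`), i.e. `‖∂ₚ(χg)‖² ≤ (1+ε)B²‖∂ₚg‖² + (1+ε⁻¹)‖Λg‖²`,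
the spectral form of the Leibniz rule `∂ₚ(χg) = χ∂ₚg + (∂ₚχ)g` for `χ ∈ W^{1,∞}` (Gilbarg–Trudinger,
(7.18); Evans §5.2.3 Thm. 1 (iv)) that avoids weak derivatives of `χ` altogether. It is the estimate
by which cutting off a Sobolev function of a hard-core Bose gas at distance `δ` from the hard core
costs `O(∫_{collar} |g|²/δ²)`, controlled by the tube Hardy inequality (`TorusPairTubeHardy`).
Proof (as in `TorusLipschitzFourierH1`): at the translation `a = s𝐞ₚ`,
`(χg)(· + a) - χg = χ(· + a)(g(· + a) - g) + (χ(· + a) - χ)g`, `|u + v|² ≤ (1+ε)|u|² + (1+ε⁻¹)|v|²`,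
Parseval `∫ |f(· + a) - f|² = ∑ₙ |e_n(a) - 1|² |f̂(n)|²` (`Torus.lintegral_enorm_sub_translate_sq_eq_tsum`),
`|e_n(s𝐞ₚ) - 1|² = (2πs)² (nₚ sinc(πnₚs))² ≤ (2πs)² nₚ²`, division by `(2πs)²` and `s → 0` on finite
partial sums.

## Mathlib / tree search

Mathlib: no Sobolev space on the torus, no Leibniz rule for `W^{1,∞}` multipliers (searched
`MemSobolev.*mul`, `fderiv.*LipschitzWith.*ae`). Tree: `TorusLipschitzFourierH1` (Lipschitz maps
acting on `H¹`, same technique; `Torus.enorm_mFourier_single_sub_one_sq`, `Torus.sq_mul_sinc_le`,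
`Torus.tendsto_sq_mul_sinc`), `TorusTranslationEstimate` (`Torus.lintegral_enorm_sub_translate_sq_eq_tsum`).

## References

* D. Gilbarg, N. S. Trudinger, *Elliptic Partial Differential Equations of Second Order* (2001),
  §7.3, eq. (7.18) (product rule in `W^{1,p}`). [GilbargTrudinger2001]
* L. C. Evans, *Partial Differential Equations*, 2nd ed. (2010), §5.2.3 Thm. 1 (iv). [Evans2010]
-/

noncomputable section

open MeasureTheory Set Filter Topology UnitAddTorus
open scoped ENNReal NNReal

namespace Literature.Analysis.FunctionSpaces

namespace Torus

variable {d : Type*} [Fintype d] [DecidableEq d]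

/-! ## The `ε`-Young inequality for squares of norms -/

/-- `‖u + v‖ₑ² ≤ (1 + ε) ‖u‖ₑ² + (1 + ε⁻¹) ‖v‖ₑ²` for `ε > 0` (from `2|u||v| ≤ ε|u|² + ε⁻¹|v|²`).
[folklore] -/
theorem enorm_add_sq_le_eps {E : Type*} [SeminormedAddCommGroup E] (u v : E) {ε : ℝ} (hε : 0 < ε) :
    ‖u + v‖ₑ ^ 2 ≤ ENNReal.ofReal (1 + ε) * ‖u‖ₑ ^ 2 + ENNReal.ofReal (1 + ε⁻¹) * ‖v‖ₑ ^ 2 := by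
  have hreal : ‖u + v‖ ^ 2 ≤ (1 + ε) * ‖u‖ ^ 2 + (1 + ε⁻¹) * ‖v‖ ^ 2 := by
    have h1 : ‖u + v‖ ^ 2 ≤ (‖u‖ + ‖v‖) ^ 2 :=
      pow_le_pow_left₀ (norm_nonneg _) (norm_add_le u v) 2
    have h2 : 2 * ‖u‖ * ‖v‖ ≤ ε * ‖u‖ ^ 2 + ε⁻¹ * ‖v‖ ^ 2 := by
      have h3 : 0 ≤ (ε * ‖u‖ - ‖v‖) ^ 2 := sq_nonneg _
      have h4 : ε⁻¹ * (ε * ‖u‖ - ‖v‖) ^ 2 = ε * ‖u‖ ^ 2 + ε⁻¹ * ‖v‖ ^ 2 - 2 * ‖u‖ * ‖v‖ := by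
        field_simp
        ring
      nlinarith [mul_nonneg (inv_nonneg.2 hε.le) h3]
    nlinarith [h1, h2]
  calc ‖u + v‖ₑ ^ 2 = ENNReal.ofReal (‖u + v‖ ^ 2) := by
        rw [← ofReal_norm, ENNReal.ofReal_pow (norm_nonneg _)]
    _ ≤ ENNReal.ofReal ((1 + ε) * ‖u‖ ^ 2 + (1 + ε⁻¹) * ‖v‖ ^ 2) := ENNReal.ofReal_le_ofReal hreal
    _ = ENNReal.ofReal (1 + ε) * ‖u‖ₑ ^ 2 + ENNReal.ofReal (1 + ε⁻¹) * ‖v‖ₑ ^ 2 := by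
        have hε1 : 0 ≤ 1 + ε := by positivity
        have hε2 : 0 ≤ 1 + ε⁻¹ := by positivity
        rw [ENNReal.ofReal_add (by positivity) (by positivity), ENNReal.ofReal_mul hε1,
          ENNReal.ofReal_mul hε2, ENNReal.ofReal_pow (norm_nonneg _), ENNReal.ofReal_pow (norm_nonneg _),
          ofReal_norm, ofReal_norm]

/-! ## The translated product -/

omit [DecidableEq d] in
/-- **Increments of a product**: for `‖χ‖ ≤ B`,
`∫ ‖(χg)(· + a) - χg‖ₑ² ≤ (1+ε) B² ∫ ‖g(· + a) - g‖ₑ² + (1+ε⁻¹) ∫ ‖χ(· + a) - χ‖ₑ² ‖g‖ₑ²`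
(`(χg)(· + a) - χg = χ(· + a)(g(· + a) - g) + (χ(· + a) - χ) g` and the `ε`-Young inequality).
[folklore] -/
theorem lintegral_enorm_mul_sub_translate_sq_le {χ g : UnitAddTorus d → ℂ} (hgm : AEStronglyMeasurable g volume)
    {B : ℝ≥0} (hB : ∀ x, ‖χ x‖ ≤ B) (a : UnitAddTorus d) {ε : ℝ} (hε : 0 < ε) :
    ∫⁻ x, ‖χ (x + a) * g (x + a) - χ x * g x‖ₑ ^ 2 ≤
      (ENNReal.ofReal (1 + ε) * (B : ℝ≥0∞) ^ 2 * ∫⁻ x, ‖g (x + a) - g x‖ₑ ^ 2) +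
        ENNReal.ofReal (1 + ε⁻¹) * ∫⁻ x, ‖χ (x + a) - χ x‖ₑ ^ 2 * ‖g x‖ₑ ^ 2 := by
  have hpt : ∀ x, ‖χ (x + a) * g (x + a) - χ x * g x‖ₑ ^ 2 ≤
      ENNReal.ofReal (1 + ε) * (B : ℝ≥0∞) ^ 2 * ‖g (x + a) - g x‖ₑ ^ 2 +
        ENNReal.ofReal (1 + ε⁻¹) * (‖χ (x + a) - χ x‖ₑ ^ 2 * ‖g x‖ₑ ^ 2) := by
    intro x
    have hsplit : χ (x + a) * g (x + a) - χ x * g x =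
        χ (x + a) * (g (x + a) - g x) + (χ (x + a) - χ x) * g x := by ring
    rw [hsplit]
    refine (enorm_add_sq_le_eps _ _ hε).trans ?_
    rw [enorm_mul, enorm_mul, mul_pow, mul_pow, mul_assoc]
    gcongr
    · rw [← ofReal_norm, ← ENNReal.ofReal_coe_nnreal]
      exact ENNReal.ofReal_le_ofReal (hB _)
  have hmeas : AEMeasurable (fun x => ENNReal.ofReal (1 + ε) * (B : ℝ≥0∞) ^ 2 * ‖g (x + a) - g x‖ₑ ^ 2) volume :=
    (((hgm.comp_measurePreserving (measurePreserving_add_right volume a)).sub hgm).enorm.pow_const 2).const_mul _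
  calc ∫⁻ x, ‖χ (x + a) * g (x + a) - χ x * g x‖ₑ ^ 2
      ≤ ∫⁻ x, (ENNReal.ofReal (1 + ε) * (B : ℝ≥0∞) ^ 2 * ‖g (x + a) - g x‖ₑ ^ 2 +
          ENNReal.ofReal (1 + ε⁻¹) * (‖χ (x + a) - χ x‖ₑ ^ 2 * ‖g x‖ₑ ^ 2)) := lintegral_mono hpt
    _ = (∫⁻ x, ENNReal.ofReal (1 + ε) * (B : ℝ≥0∞) ^ 2 * ‖g (x + a) - g x‖ₑ ^ 2) +
          ∫⁻ x, ENNReal.ofReal (1 + ε⁻¹) * (‖χ (x + a) - χ x‖ₑ ^ 2 * ‖g x‖ₑ ^ 2) :=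
        lintegral_add_left' hmeas _
    _ = _ := by
        rw [lintegral_const_mul' _ _ (ENNReal.mul_ne_top ENNReal.ofReal_ne_top (ENNReal.pow_ne_top ENNReal.coe_ne_top)),
          lintegral_const_mul' _ _ ENNReal.ofReal_ne_top]

/-- The directional Lipschitz term at `a = s𝐞ₚ`: if `‖χ(x + s𝐞ₚ) - χ(x)‖ₑ ≤ |s| Λ(x)` then
`∫ ‖χ(· + s𝐞ₚ) - χ‖ₑ² ‖g‖ₑ² ≤ s² ∫ Λ² ‖g‖ₑ²`. [folklore] -/
theorem lintegral_enorm_sub_translate_sq_mul_le {χ : UnitAddTorus d → ℂ} (g : UnitAddTorus d → ℂ) (p : d)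
    {Λ : UnitAddTorus d → ℝ≥0∞} {s : ℝ}
    (hΛ : ∀ x, ‖χ (x + Pi.single p ((s : ℝ) : UnitAddCircle)) - χ x‖ₑ ≤ ENNReal.ofReal |s| * Λ x) :
    ∫⁻ x, ‖χ (x + Pi.single p ((s : ℝ) : UnitAddCircle)) - χ x‖ₑ ^ 2 * ‖g x‖ₑ ^ 2 ≤
      ENNReal.ofReal (s ^ 2) * ∫⁻ x, Λ x ^ 2 * ‖g x‖ₑ ^ 2 := by
  rw [← lintegral_const_mul' _ _ ENNReal.ofReal_ne_top]
  refine lintegral_mono fun x => ?_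
  have h1 : ‖χ (x + Pi.single p ((s : ℝ) : UnitAddCircle)) - χ x‖ₑ ^ 2 ≤ ENNReal.ofReal (s ^ 2) * Λ x ^ 2 := by
    have h := mul_le_mul' (hΛ x) (hΛ x)
    rwa [← pow_two, ← pow_two, mul_pow, ← ENNReal.ofReal_pow (abs_nonneg _), sq_abs] at h
  exact (mul_le_mul_left h1 _).trans_eq (mul_assoc _ _ _)

/-! ## The Leibniz estimate -/

omit [DecidableEq d] in
/-- The multiplied function is again in `L²`. [folklore] -/
theorem memLp_two_mul_of_bound {χ g : UnitAddTorus d → ℂ} (hχ : AEStronglyMeasurable χ volume)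
    {B : ℝ≥0} (hB : ∀ x, ‖χ x‖ ≤ B) (hg : MemLp g 2 volume) :
    MemLp (fun x => χ x * g x) 2 volume :=
  hg.of_le_mul (hχ.mul hg.1) (ae_of_all _ fun x => by
    rw [norm_mul]; exact mul_le_mul_of_nonneg_right (hB x) (norm_nonneg _))

/-- **At one difference quotient**: for `s ≠ 0` with the directional Lipschitz bound at `s`,
`∑ₙ (nₚ sinc(πnₚs))² ‖𝓕(χg)(n)‖² ≤ (1+ε)B² ∑ₙ (nₚ sinc(πnₚs))² ‖ĝ(n)‖² + (1+ε⁻¹)(4π²)⁻¹ ∫⁻ Λ² ‖g‖²`.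
[folklore] -/
theorem tsum_sincWeight_mul_le {χ g : UnitAddTorus d → ℂ} (hχ : AEStronglyMeasurable χ volume)
    {B : ℝ≥0} (hB : ∀ x, ‖χ x‖ ≤ B) (hg : MemLp g 2 volume) (p : d) {Λ : UnitAddTorus d → ℝ≥0∞}
    {s : ℝ} (hs : s ≠ 0)
    (hΛ : ∀ x, ‖χ (x + Pi.single p ((s : ℝ) : UnitAddCircle)) - χ x‖ₑ ≤ ENNReal.ofReal |s| * Λ x)
    {ε : ℝ} (hε : 0 < ε) :
    ∑' n : d → ℤ, ENNReal.ofReal (((n p : ℝ) * Real.sinc (Real.pi * (n p) * s)) ^ 2) *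
        ‖mFourierCoeff (fun x => χ x * g x) n‖ₑ ^ 2 ≤
      (ENNReal.ofReal (1 + ε) * (B : ℝ≥0∞) ^ 2 *
          ∑' n : d → ℤ, ENNReal.ofReal (((n p : ℝ) * Real.sinc (Real.pi * (n p) * s)) ^ 2) *
            ‖mFourierCoeff g n‖ₑ ^ 2) +
        ENNReal.ofReal (1 + ε⁻¹) * ENNReal.ofReal (1 / (2 * Real.pi) ^ 2) * ∫⁻ x, Λ x ^ 2 * ‖g x‖ₑ ^ 2 := by
  set a : UnitAddTorus d := Pi.single p ((s : ℝ) : UnitAddCircle) with ha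
  have hχg : MemLp (fun x => χ x * g x) 2 volume := memLp_two_mul_of_bound hχ hB hg
  -- the increment inequality, in spectral form on the left and for the `g`-term
  have h1 := lintegral_enorm_mul_sub_translate_sq_le hg.1 hB a hε
  rw [lintegral_enorm_sub_translate_sq_eq_tsum hχg a, lintegral_enorm_sub_translate_sq_eq_tsum hg a] at h1
  have h2 := lintegral_enorm_sub_translate_sq_mul_le g p hΛ
  have h3 := h1.trans (add_le_add_right (mul_le_mul_right h2 _) _)
  -- cancel `(2πs)²`
  simp only [ha, enorm_mFourier_single_sub_one_sq] at h3
  simp_rw [mul_assoc (ENNReal.ofReal ((2 * Real.pi * s) ^ 2)), ENNReal.tsum_mul_left] at h3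
  set c : ℝ≥0∞ := ENNReal.ofReal ((2 * Real.pi * s) ^ 2) with hc_def
  have hc0 : c ≠ 0 := by
    rw [hc_def, Ne, ENNReal.ofReal_eq_zero, not_le]
    exact sq_pos_iff.2 (mul_ne_zero (mul_ne_zero two_ne_zero Real.pi_pos.ne') hs)
  have hcs : ENNReal.ofReal (1 + ε⁻¹) * (ENNReal.ofReal (s ^ 2) * ∫⁻ x, Λ x ^ 2 * ‖g x‖ₑ ^ 2) =
      c * (ENNReal.ofReal (1 + ε⁻¹) * ENNReal.ofReal (1 / (2 * Real.pi) ^ 2) *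
        ∫⁻ x, Λ x ^ 2 * ‖g x‖ₑ ^ 2) := by
    have : ENNReal.ofReal (s ^ 2) = c * ENNReal.ofReal (1 / (2 * Real.pi) ^ 2) := by
      rw [hc_def, ← ENNReal.ofReal_mul (sq_nonneg _)]
      congr 1
      field_simp
    rw [this]
    ring
  rw [hcs, mul_left_comm (ENNReal.ofReal (1 + ε) * (B : ℝ≥0∞) ^ 2) c, ← mul_add] at h3
  exact (ENNReal.mul_le_mul_iff_right hc0 ENNReal.ofReal_ne_top).1 h3

/-- **Leibniz rule for a bounded, directionally Lipschitz multiplier in the spectral `H¹`.**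
For `g ∈ L²(T^d; ℂ)`, a coordinate `p`, a measurable `χ : T^d → ℂ` with `‖χ‖ ≤ B` and
`‖χ(x + s𝐞ₚ) - χ(x)‖ₑ ≤ |s| Λ(x)` for all `x` and `|s| ≤ s₀` (`s₀ > 0`, `Λ : T^d → [0, ∞]`), and
`ε > 0`:
`∑ₙ nₚ² ‖𝓕(χg)(n)‖ₑ² ≤ (1+ε) B² ∑ₙ nₚ² ‖ĝ(n)‖ₑ² + (1+ε⁻¹) (4π²)⁻¹ ∫⁻ Λ² ‖g‖ₑ²`
(Gilbarg–Trudinger (7.18) in Fourier dress: `‖∂ₚ(χg)‖ ≤ B‖∂ₚg‖ + ‖Λg‖` up to `ε`).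
[cite: GilbargTrudinger2001, eq. (7.18)] -/
theorem tsum_sq_mul_enorm_mFourierCoeff_mul_le {χ g : UnitAddTorus d → ℂ} (hχ : AEStronglyMeasurable χ volume)
    {B : ℝ≥0} (hB : ∀ x, ‖χ x‖ ≤ B) (hg : MemLp g 2 volume) (p : d) {Λ : UnitAddTorus d → ℝ≥0∞}
    {s₀ : ℝ} (hs₀ : 0 < s₀)
    (hΛ : ∀ x (s : ℝ), |s| ≤ s₀ →
      ‖χ (x + Pi.single p ((s : ℝ) : UnitAddCircle)) - χ x‖ₑ ≤ ENNReal.ofReal |s| * Λ x)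
    {ε : ℝ} (hε : 0 < ε) :
    ∑' n : d → ℤ, ENNReal.ofReal ((n p : ℝ) ^ 2) * ‖mFourierCoeff (fun x => χ x * g x) n‖ₑ ^ 2 ≤
      (ENNReal.ofReal (1 + ε) * (B : ℝ≥0∞) ^ 2 *
          ∑' n : d → ℤ, ENNReal.ofReal ((n p : ℝ) ^ 2) * ‖mFourierCoeff g n‖ₑ ^ 2) +
        ENNReal.ofReal (1 + ε⁻¹) * ENNReal.ofReal (1 / (2 * Real.pi) ^ 2) * ∫⁻ x, Λ x ^ 2 * ‖g x‖ₑ ^ 2 := by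
  set R : ℝ≥0∞ := (ENNReal.ofReal (1 + ε) * (B : ℝ≥0∞) ^ 2 *
      ∑' n : d → ℤ, ENNReal.ofReal ((n p : ℝ) ^ 2) * ‖mFourierCoeff g n‖ₑ ^ 2) +
    ENNReal.ofReal (1 + ε⁻¹) * ENNReal.ofReal (1 / (2 * Real.pi) ^ 2) * ∫⁻ x, Λ x ^ 2 * ‖g x‖ₑ ^ 2 with hR
  -- the steps `sⱼ = s₀/(j+1) → 0`, `0 < sⱼ ≤ s₀`
  set sq : ℕ → ℝ := fun j => s₀ / ((j : ℝ) + 1) with hsq_def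
  have hsq0 : ∀ j, sq j ≠ 0 := fun j => div_ne_zero hs₀.ne' (by positivity)
  have hsqle : ∀ j, |sq j| ≤ s₀ := fun j => by
    rw [hsq_def]
    simp only
    rw [abs_of_pos (div_pos hs₀ (by positivity)), div_le_iff₀ (by positivity)]
    nlinarith [(Nat.cast_nonneg j : (0 : ℝ) ≤ j)]
  have hslim : Tendsto sq atTop (𝓝 0) := by
    have := tendsto_one_div_add_atTop_nhds_zero_nat.const_mul s₀
    rw [mul_zero] at this
    refine this.congr fun j => ?_
    simp only [hsq_def]
    ring
  -- at every step the weighted sum is bounded by `R`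
  have hstep : ∀ j, ∑' n : d → ℤ, ENNReal.ofReal (((n p : ℝ) * Real.sinc (Real.pi * (n p) * sq j)) ^ 2) *
      ‖mFourierCoeff (fun x => χ x * g x) n‖ₑ ^ 2 ≤ R := fun j =>
    (tsum_sincWeight_mul_le hχ hB hg p (hsq0 j) (fun x => hΛ x (sq j) (hsqle j)) hε).trans
      (add_le_add_left (mul_le_mul_right (ENNReal.tsum_le_tsum fun n => mul_le_mul_left
        (ENNReal.ofReal_le_ofReal (sq_mul_sinc_le _ _)) _) _) _)
  -- pass to the limit on finite partial sums
  rw [ENNReal.tsum_eq_iSup_sum]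
  refine iSup_le fun S => ?_
  have hlim : Tendsto (fun j => ∑ n ∈ S, ENNReal.ofReal (((n p : ℝ) * Real.sinc (Real.pi * (n p) * sq j)) ^ 2) *
      ‖mFourierCoeff (fun x => χ x * g x) n‖ₑ ^ 2) atTop
      (𝓝 (∑ n ∈ S, ENNReal.ofReal ((n p : ℝ) ^ 2) * ‖mFourierCoeff (fun x => χ x * g x) n‖ₑ ^ 2)) := by
    refine tendsto_finsetSum _ fun n _ => ?_
    exact ENNReal.Tendsto.mul_const ((ENNReal.continuous_ofReal.tendsto _).comp
      (tendsto_sq_mul_sinc (n p) hslim)) (Or.inr (ENNReal.pow_ne_top enorm_ne_top))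
  exact le_of_tendsto' hlim fun j => (ENNReal.sum_le_tsum S).trans (hstep j)

end Torus

end Literature.Analysis.FunctionSpaces

end
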